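import Literature.AlgebraicGeometry.Modules.SerreTwistOneAmplePullback
import Literature.AlgebraicGeometry.Modules.ProjectiveFamilyTwistPushforward
import Literature.AlgebraicGeometry.Modules.CechPicOfLocalRing
import Literature.AlgebraicGeometry.Modules.UnitCocyclePresented
import Literature.AlgebraicGeometry.Morphisms.ProjectiveSpaceOverAffine
import Literature.AlgebraicGeometry.Morphisms.ProjectiveSpaceOverBasePoints
import Literature.AlgebraicGeometry.Morphisms.ProjectiveMorphism
import Literature.AlgebraicGeometry.AbelianSchemes.AbelianSchemeDualPair
import Literature.AlgebraicGeometry.Morphisms.LocallyNoetherianLocallyConnected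
import Literature.AlgebraicGeometry.AbelianVarieties.TheoremOfTheSquareCechPic
import HarnessLib

/-!
# A projective abelian scheme carries, affine-locally on the base, a rigidified line bundle that is fibrewise the
# class of an ample divisor

Topic `Literature/AlgebraicGeometry/AbelianSchemes`; namespaces `Literature.AlgebraicGeometry.Morphisms` (§1–§2b),
`Literature.AlgebraicGeometry.AbelianSchemes` (§3).  THEOREMS ONLY (no definition,
no named fact, no instance, no notation, no `sorry`).  Cell `hodgecm-mathlib` (D-0151 / D-0183 FLOOR 0), programme P1, sub-line F-3
«dual abelian scheme» (`F0/P1/Lines/F3DualAbelianScheme`, B-plan1 (g19)), stub **(L) `stub_F3L`** — the letter is proved here VERBATIM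
as `AbelianSchemeOver.exists_affine_rigidified_fibrewise_ample_of_isProjective`.  Count-neutral capital: HC_CM is proved only modulo
the 7 printed citations until rung 0 closes — nothing here bears on a summit statement.

MATHEMATICS ([MumfordFogartyKirwan1994] Ch. 6 §1, the standing hypothesis «`X → S` projective» of Cor. 6.8 (p. 118), read as in
[MumfordAV1970] §6 Application 1 (pp. 60–61) / §13: a projective abelian scheme carries a relatively ample `L = 𝒪(1)|_A`).  Let
`A → S` be an abelian scheme over a locally noetherian `ℚ`-scheme with a closed `S`-immersion `j : A ↪ 𝐏(ι; S)` ([Hartshorne1977] II §4,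
p. 103).  For `s ∈ S` pick an affine open `Spec R ∋ s` (`R` noetherian, a `ℚ`-algebra through `S → Spec ℚ`).  Over it `j` base-changes to a
closed immersion `ιZ : A_R ↪ 𝐏ⁿ_R = Proj R[x₀, …, xₙ]` (`n = #ι`; ★ `isPullback_projectiveSpaceMap`,
★ `isPullback_projToSpec_projMap_terminal`),
and `d := [𝒪_{A_R}(1)] ∈ Ȟ¹(A_R, 𝒪^×)` (★ `SerreTwist.twistMod`, ★ `detClass`).  RIGIDIFICATION: replace `d` by
`c := d · (π^* ε^* d)⁻¹` — then `ε^* c = ε^*d · ((ε ≫ π)^* ε^* d)⁻¹ = 1` since `ε ≫ π = 𝟙` (★ `CechPic.pullback_id`), and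
`L := 𝒪(c)` (★ `Modules.lineBundle`, every
Čech class is the class of a line bundle, [Hartshorne1977] III Ex. 4.5) is the required rank-one module; no shrinking of the chart is
needed.  FIBRES: at a geometric point `t : Spec Ω → Spec R` the correction dies (`Ȟ¹(Spec Ω, 𝒪^×) = 1`, ★ `CechPic.pullback_eq_one_of_isLocalRing`),
so `k^* c = k^* d = [k^*𝒪_{A_R}(1)]`, and `k^*𝒪_{A_R}(1) ≅ 𝒪_{A_t}(Θ)` with `Θ` an AMPLE Cartier divisor (a hyperplane
section) by the
fibre form ★ `SerreTwist.exists_isAmple_nonempty_pullback_twistMod_one_iso_lineBundle_of_sq` ([MumfordFogartyKirwan1994] Prop. 7.3,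
proof, step (V); [GortzWedhorn2020] Prop. 13.66 (2)), applied to the closed immersion `ιK : A_t ↪ 𝐏ⁿ_Ω` base-changed from `ιZ` (★
`ProjBaseChangeRing.isPullback_projMap'`), `A_t` being integral (abelian variety over a field).

* §1 `exists_isClosedImmersion_projectiveSpace_pullback` — base change of a closed `Y`-immersion `X ↪ 𝐏(ι; Y)` along `u : Y' → Y` is a
  closed `Y'`-immersion `X ×_Y Y' ↪ 𝐏(ι; Y')` in a cartesian square over `j` (the square behind ★ `isProjective_pullback_snd`).
* §2 `exists_isClosedImmersion_toPP_pullback_spec` — over an affine base the same lands in `𝐏ⁿ_R = Proj R[x]` over `Spec R` (its base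
  change along `Spec Ω → Spec R` to a closed immersion into `𝐏ⁿ_Ω`, in the square of ★ `ProjBaseChangeRing.isPullback_projMap'`, is done
  inside §3 — `MvPolynomial.gradedAlgebra` is a `def` in Mathlib, supplied there by `letI` as in ★ `SiegelModuliQuasiProjective`).
* §2b `exists_connected_affine_nbhd` — every point of a locally noetherian scheme has a CONNECTED affine open neighbourhood (the connected
  component of the point in an affine chart is clopen, ★ `isClopen_connectedComponent_of_isLocallyNoetherian`, hence a basic open `D(e)` of an
  idempotent, Mathlib `PrimeSpectrum.exists_idempotent_basicOpen_eq_of_isClopen`; [GortzWedhorn2020] Exercises 3.15–3.16);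
  **`AbelianSchemeOver.exists_affine_rigidified_fibrewise_ample_of_isProjective`** = the (L) letter (edition 1.2 of the line: the chart
  `Spec R` is moreover CONNECTED).

## References
* D. Mumford, J. Fogarty, F. Kirwan, *Geometric Invariant Theory*, 3rd ed. (1994), Ch. 6 §1 Cor. 6.8 (p. 118); Ch. 7 §2 Prop. 7.3, proof,
  step (V) (p. 134). [MumfordFogartyKirwan1994]
* D. Mumford, *Abelian Varieties* (1970), §6 Application 1 (pp. 60–61). [MumfordAV1970]
* R. Hartshorne, *Algebraic Geometry*, GTM 52 (1977): II §4 Definition (p. 103), II Prop. 5.12 (c) (p. 117), II Ex. 3.11 (a), III Ex. 4.5.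
  [Hartshorne1977]
* U. Görtz, T. Wedhorn, *Algebraic Geometry I: Schemes*, 2nd ed. (2020): Section (3.8) and Exercises 3.15–3.16 (p. 92), Section (4.12)
  (p. 113), Remark 13.27 with (13.7.1) (pp. 382–384), Prop. 13.66 (2). [GortzWedhorn2020]
* The Stacks Project, Tag 04MF (locally Noetherian spaces are locally connected), Tag 00EE (idempotents and clopen subsets). [StacksProject]
-/

noncomputable section

-- Mathlib's pull-back API is stated through `abbrev`s over `limit`; as in Mathlib's own algebraic-geometry files (and the
-- tree's `Morphisms/ProjectiveSpaceOverAffine`, `Modules/SerreTwistOneAmplePullback`) we let unification see through them.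
set_option backward.isDefEq.respectTransparency false

universe u

open CategoryTheory CategoryTheory.Limits AlgebraicGeometry TopologicalSpace Opposite

/-! ## §1 Base change of a closed immersion into `𝐏(ι; Y)` -/

namespace Literature.AlgebraicGeometry.Morphisms

open Literature.AlgebraicGeometry.Motives (ProjBaseChangeRing.mapGraded ProjBaseChangeRing.irrelevant_le_map
  ProjBaseChangeRing.projToSpec)
open ProjCech (PP)

/-- **Base change of a closed immersion into projective space over a base** ([Hartshorne1977] II Ex. 3.11 (a) + `𝐏(ι; Y') =
Y' ×_Y 𝐏(ι; Y)`, ★ `isPullback_projectiveSpaceMap`): if `j : X ↪ 𝐏(ι; Y)` is a closed immersion over `f : X → Y`, then for every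
`u : Y' → Y` the base change `X ×_Y Y'` embeds into `𝐏(ι; Y')` over `Y'` by a closed immersion `j'`, and the square `(j', pr₁; j)` over
`𝐏(ι; Y') → 𝐏(ι; Y)` commutes (it is cartesian).  This is the square inside ★ `isProjective_pullback_snd`, exposed.
[cite: Hartshorne1977, II §4 Definition p.103 (projective morphism) and II Ex. 3.11 (a)]
[cite: GortzWedhorn2020, Section (4.12)] -/
theorem exists_isClosedImmersion_projectiveSpace_pullback {X Y Y' : Scheme.{u}} (ι : Type u) [Finite ι] {f : X ⟶ Y}
    (j : X ⟶ projectiveSpace ι Y) [IsClosedImmersion j] (hjf : j ≫ projectiveSpaceFst ι Y = f) (u : Y' ⟶ Y) :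
    ∃ j' : pullback f u ⟶ projectiveSpace ι Y', IsClosedImmersion j' ∧ j' ≫ projectiveSpaceFst ι Y' = pullback.snd f u ∧
      j' ≫ projectiveSpaceMap ι u = pullback.fst f u ≫ j := by
  have w : (pullback.fst f u ≫ j) ≫ projectiveSpaceFst ι Y = pullback.snd f u ≫ u := by
    rw [Category.assoc, hjf, pullback.condition]
  let j' : pullback f u ⟶ projectiveSpace ι Y' :=
    (isPullback_projectiveSpaceMap ι u).lift (pullback.fst f u ≫ j) (pullback.snd f u) w
  have hj'₁ : j' ≫ projectiveSpaceMap ι u = pullback.fst f u ≫ j := (isPullback_projectiveSpaceMap ι u).lift_fst _ _ w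
  have hj'₂ : j' ≫ projectiveSpaceFst ι Y' = pullback.snd f u := (isPullback_projectiveSpaceMap ι u).lift_snd _ _ w
  have hsq : IsPullback j' (pullback.fst f u) (projectiveSpaceMap ι u) j := by
    refine IsPullback.of_right (h₁₂ := projectiveSpaceFst ι Y') (v₁₃ := u) (h₂₂ := projectiveSpaceFst ι Y) ?_ hj'₁
      (isPullback_projectiveSpaceMap ι u).flip
    rw [hj'₂, hjf]
    exact (IsPullback.of_hasPullback f u).flip
  exact ⟨j', MorphismProperty.of_isPullback (P := @IsClosedImmersion) hsq.flip ‹_›, hj'₂, hj'₁⟩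

/-! ## §2 Over an affine base: closed immersions into `𝐏ⁿ_R = Proj R[x₀, …, xₙ]` and their fibres -/

/-- **Over an affine base `Spec R → Y` the base change of a closed `Y`-immersion `X ↪ 𝐏(ι; Y)` is a closed immersion
`X ×_Y Spec R ↪ 𝐏ⁿ_R = Proj R[x₀, …, xₙ]` OVER `Spec R`** (`n = #ι`; §1 followed by ★ `Proj R[x] ≅ 𝐏(ι; Spec R)` over `Spec R`,
[GortzWedhorn2020] (4.12) «if `S = Spec R` is affine, `ℙⁿ_{Spec R}` is the projective space `ℙⁿ_R`»).
[cite: GortzWedhorn2020, Section (4.12) (p. 113)] [cite: Hartshorne1977, II §4 Definition p.103 (projective morphism)] -/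
theorem exists_isClosedImmersion_toPP_pullback_spec {X Y : Scheme.{u}} (ι : Type u) [Finite ι] {f : X ⟶ Y}
    (j : X ⟶ projectiveSpace ι Y) [IsClosedImmersion j] (hjf : j ≫ projectiveSpaceFst ι Y = f)
    (R : Type u) [CommRing R] [Algebra intU.{u} R] (u : Spec (.of R) ⟶ Y) :
    ∃ ιZ : pullback f u ⟶ PP R (Nat.card ι), IsClosedImmersion ιZ ∧
      ιZ ≫ ProjBaseChangeRing.projToSpec (Fin (Nat.card ι + 1)) R = pullback.snd f u := by
  obtain ⟨j', hj', hj'₂, -⟩ := exists_isClosedImmersion_projectiveSpace_pullback ι j hjf u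
  refine ⟨j' ≫ (isPullback_projToSpec_projMap_terminal ι R).isoPullback.inv, inferInstance, ?_⟩
  rw [Category.assoc, projectiveSpaceSpec_isoPullback_inv_projToSpec, hj'₂]

/-! ## §2b Connected affine open neighbourhoods in a locally noetherian scheme -/

/-- **Every point of a locally noetherian scheme has a CONNECTED affine open neighbourhood**: in an affine open `Spec R₀ ∋ s` (locally
noetherian) the connected component of `s` is clopen (★ `isClopen_connectedComponent_of_isLocallyNoetherian`), hence the basic open `D(e)` of
an idempotent `e` (Mathlib `PrimeSpectrum.exists_idempotent_basicOpen_eq_of_isClopen`), and `Spec R₀[e⁻¹] → Spec R₀ → S` is an open immersion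
onto it with connected source (an open embedding onto a connected set). [cite: GortzWedhorn2020, Section (3.8) and Exercises 3.15–3.16 (p. 92)]
[cite: StacksProject, Tag 04MF] -/
theorem exists_connected_affine_nbhd {S : Scheme.{u}} [IsLocallyNoetherian S] (s : S) :
    ∃ (R : Type u) (_ : CommRing R) (i : Spec (.of R) ⟶ S),
      IsOpenImmersion i ∧ s ∈ Set.range i.base ∧ ConnectedSpace ↥(Spec (.of R)) := by
  -- an affine open `Spec R₀ ∋ s`
  obtain ⟨R₀, i₀, hi₀, ⟨s₀, rfl⟩, -⟩ := Scheme.exists_affine_mem_range_and_range_subset (U := ⊤) (x := s) trivial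
  haveI := hi₀
  haveI : IsLocallyNoetherian (Spec R₀) := isLocallyNoetherian_of_isOpenImmersion i₀
  -- the connected component of `s₀` is clopen, hence `D(e)` for an idempotent `e`
  obtain ⟨e, -, he⟩ := PrimeSpectrum.exists_idempotent_basicOpen_eq_of_isClopen (R := R₀) (s := connectedComponent s₀)
    (isClopen_connectedComponent_of_isLocallyNoetherian (Spec R₀) s₀)
  have hrange : Set.range (Spec.map (CommRingCat.ofHom (algebraMap R₀ (Localization.Away e)))).base = connectedComponent s₀ := by
    rw [he, ← Scheme.Hom.coe_opensRange, Scheme.Hom.opensRange_localizationAway]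
  obtain ⟨x, hx⟩ : s₀ ∈ Set.range (Spec.map (CommRingCat.ofHom (algebraMap R₀ (Localization.Away e)))).base := by
    rw [hrange]; exact mem_connectedComponent
  refine ⟨Localization.Away e, inferInstance, Spec.map (CommRingCat.ofHom (algebraMap R₀ (Localization.Away e))) ≫ i₀, inferInstance,
    ⟨x, by rw [Scheme.Hom.comp_apply, hx]; rfl⟩, ?_⟩
  -- the source is homeomorphic onto the connected set `connectedComponent s₀`
  rw [connectedSpace_iff_univ]
  refine ⟨⟨x, trivial⟩, ?_⟩
  rw [← (Spec.map (CommRingCat.ofHom (algebraMap R₀ (Localization.Away e)))).isOpenEmbedding.isInducing.isPreconnected_image,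
    Set.image_univ, hrange]
  exact isPreconnected_connectedComponent

end Literature.AlgebraicGeometry.Morphisms

/-! ## §3 The (L) letter of the F-3 sub-line -/

namespace Literature.AlgebraicGeometry.AbelianSchemes

open Literature.AlgebraicGeometry.AbelianSchemes Literature.AlgebraicGeometry.Motives
  Literature.AlgebraicGeometry.AbelianVarieties Literature.AlgebraicGeometry.Modules
open Literature.AlgebraicGeometry.Morphisms (IsProjective intU projectiveSpace projectiveSpaceFst
  exists_isClosedImmersion_toPP_pullback_spec exists_connected_affine_nbhd)
open Literature.AlgebraicGeometry.Morphisms.ProjCech (PP)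
open Literature.AlgebraicGeometry.Motives (ProjBaseChangeRing.projToSpec)

/-- **(L) «A PROJECTIVE ABELIAN SCHEME CARRIES, AFFINE-LOCALLY ON THE BASE, A RIGIDIFIED LINE BUNDLE WHICH IS FIBREWISE THE CLASS OF
AN AMPLE DIVISOR»** — the letter `stub_F3L` of the F-3 sub-line `F0/P1/Lines/F3DualAbelianScheme` (B-plan1 (g19)) VERBATIM: for `A → S`
projective (★ `Morphisms.IsProjective`: a closed `S`-immersion into `𝐏(ι; S)`) over a locally noetherian `ℚ`-scheme `S` and `s ∈ S`, there
are a CONNECTED affine open `Spec R ↪ S` through `s` (§2b `exists_connected_affine_nbhd`; `R` noetherian — `S` is locally noetherian —, a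
`ℚ`-algebra through `S → Spec ℚ`) and on
`A ×_S Spec R` a rank-one `L` whose class is `1` along the unit section and restricts, on every geometric fibre, to the class of an AMPLE
Cartier divisor — literally the hypotheses `(hL, hε, hΘ)` of
★ `AbelianSchemeOver.exists_isClosedImmersion_isFinite_iff_memKOfL_of_isNoetherianRing`.
`L := 𝒪(c)` for `c = [𝒪_{A_R}(1)] · (π^* ε^*[𝒪_{A_R}(1)])⁻¹` (§ module docstring): the unit-section class is `1` because `ε ≫ π = 𝟙`, the
correction is invisible on geometric fibres (`Pic (Spec Ω) = 1`), and `𝒪_{A_R}(1)|_{A_t} = 𝒪(Θ)` with `Θ` an ample hyperplane section of the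
integral fibre ([MumfordFogartyKirwan1994] Prop. 7.3 step (V); [MumfordAV1970] §6 Application 1: an abelian variety embedded in `𝐏ⁿ`
carries the ample class of a hyperplane section).
[cite: MumfordFogartyKirwan1994, Ch. 6 §1 Corollary 6.8 (p. 118) (standing hypothesis «projective») and Ch. 7 §2 Prop. 7.3, proof, step (V) (p. 134)]
[cite: MumfordAV1970, §6 Application 1 and its proof (pp. 60–61)] [cite: Hartshorne1977, II §4 Definition p.103 (projective morphism) and III Ex. 4.5] -/
theorem AbelianSchemeOver.exists_affine_rigidified_fibrewise_ample_of_isProjective :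
    ∀ ⦃S : Scheme.{0}⦄ [IsLocallyNoetherian S] (_fS : S ⟶ Spec (.of ℚ)) (A : AbelianSchemeOver S),
    IsProjective A.X.hom → ∀ s : S, ∃ (R : Type) (_ : CommRing R) (_ : IsNoetherianRing R) (_ : Algebra ℚ R)
      (_ : ConnectedSpace ↥(Spec (.of R))) (i : Spec (.of R) ⟶ S) (_ : IsOpenImmersion i) (_ : s ∈ Set.range i.base)
      (L : (A.baseChange i).left.Modules) (hL : HasRank L 1),
      CechPic.pullback (A.baseChange i).unitSection (detClass (HasRank.isFiniteLocallyFree' hL)) = 1 ∧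
      ∀ ⦃Ω : Type⦄ [Field Ω] [IsAlgClosed Ω] (t : Spec (.of Ω) ⟶ Spec (.of R)),
        ∃ Θ : CartierDivisor ((A.baseChange i).fibre t).toAbelianVariety.X.left, Θ.IsAmple ∧
          CechPic.pullback (X := ((A.baseChange i).fibre t).toAbelianVariety.X.left) (pullback.fst (A.baseChange i).X.hom t)
            (detClass (HasRank.isFiniteLocallyFree' hL)) = Θ.cechClass := by
  intro S _ fS A hA s
  obtain ⟨ι, _, j, hj, hjA⟩ := hA
  -- a connected affine open `Spec R ∋ s`; `R` is noetherian and a `ℚ`-algebra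
  obtain ⟨R, _, i, hi, hs, hconn⟩ := exists_connected_affine_nbhd s
  haveI := hi
  haveI : IsLocallyNoetherian (Spec (.of R)) := isLocallyNoetherian_of_isOpenImmersion i
  haveI : IsNoetherianRing R := (isLocallyNoetherian_Spec (R := .of R)).mp inferInstance
  letI : Algebra ℚ R := RingHom.toAlgebra (R := ℚ) (S := R) (Spec.preimage (i ≫ fS)).hom
  letI : Algebra intU.{0} R := RingHom.toAlgebra (R := intU.{0}) (S := R)
    ((Int.castRingHom R).comp (ULift.ringEquiv : ULift.{0} ℤ ≃+* ℤ).toRingHom)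
  -- `ιZ : A_R ↪ 𝐏ⁿ_R` over `Spec R`
  obtain ⟨ιZ₀, hιZ₀, hιZπ₀⟩ := exists_isClosedImmersion_toPP_pullback_spec ι j hjA R i
  -- re-read over `(A.baseChange i).left` (definitionally `A ×_S Spec R`, ★ `AbelianSchemeOver.baseChange_left`)
  let ιZ : (A.baseChange i).left ⟶ PP R (Nat.card ι) := ιZ₀
  haveI hιZ : IsClosedImmersion ιZ := hιZ₀
  have hιZπ : ιZ ≫ ProjBaseChangeRing.projToSpec (Fin (Nat.card ι + 1)) R = (A.baseChange i).X.hom := hιZπ₀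
  -- `d := [𝒪_{A_R}(1)]`, the rigidified class `c := d · (π^* ε^* d)⁻¹` and `L := 𝒪(c)`
  have hd : IsFiniteLocallyFree (SerreTwist.twistMod ιZ (unitModule (A.baseChange i).left) 1) :=
    isFiniteLocallyFree_twistMod_unitModule ιZ 1
  obtain ⟨c, hc⟩ := CechPic.mk_surjective (detClass hd *
    (CechPic.pullback (A.baseChange i).X.hom (CechPic.pullback (A.baseChange i).unitSection (detClass hd)))⁻¹)
  have hcl : detClass (HasRank.isFiniteLocallyFree' c.hasRank_lineBundle) = detClass hd *
      (CechPic.pullback (A.baseChange i).X.hom (CechPic.pullback (A.baseChange i).unitSection (detClass hd)))⁻¹ := by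
    rw [← hc]; exact c.detClass_lineBundle
  refine ⟨R, inferInstance, inferInstance, inferInstance, hconn, i, hi, hs, Modules.lineBundle c, c.hasRank_lineBundle, ?_, ?_⟩
  · -- `ε^* c = ε^* d · ((ε ≫ π)^* ε^* d)⁻¹ = 1`
    have h1 : CechPic.pullback (A.baseChange i).unitSection (detClass (HasRank.isFiniteLocallyFree' c.hasRank_lineBundle)) = 1 := by
      rw [hcl, map_mul, map_inv, ← CechPic.pullback_comp, AbelianSchemeOver.unitSection_comp_hom, CechPic.pullback_id,
        mul_inv_cancel]
    exact h1
  · intro Ω _ _ t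
    -- write `t = Spec (φ : R → Ω)` and make `Ω` an `R`-algebra through `φ`
    obtain ⟨φ, rfl⟩ : ∃ φ : CommRingCat.of R ⟶ CommRingCat.of Ω, Spec.map φ = t := ⟨Spec.preimage t, Spec.map_preimage t⟩
    letI : Algebra R Ω := RingHom.toAlgebra (R := R) (S := Ω) φ.hom
    -- Mathlib keeps `MvPolynomial.gradedAlgebra` a `def` (as in ★ `SiegelModuliQuasiProjective`, supplied by `letI`)
    letI := MvPolynomial.gradedAlgebra (σ := Fin (Nat.card ι + 1)) (R := R)
    letI := MvPolynomial.gradedAlgebra (σ := Fin (Nat.card ι + 1)) (R := Ω)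
    have hφ : Spec.map (CommRingCat.ofHom (algebraMap R Ω)) = Spec.map φ := rfl
    -- `𝐏ⁿ_Ω = 𝐏ⁿ_R ×_R Spec Ω` (★ `ProjBaseChangeRing.isPullback_projMap'`) and the fibre `ιK : A_t ↪ 𝐏ⁿ_Ω`, a closed immersion
    -- (base change of `ιZ`) of an integral scheme, in a square over `𝐏ⁿ_Ω → 𝐏ⁿ_R`
    have P := Literature.AlgebraicGeometry.Motives.ProjBaseChangeRing.isPullback_projMap' R Ω (n := Nat.card ι)
    rw [hφ] at P
    have w₀ : (pullback.fst (A.baseChange i).X.hom (Spec.map φ) ≫ ιZ) ≫ ProjBaseChangeRing.projToSpec (Fin (Nat.card ι + 1)) R =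
        pullback.snd (A.baseChange i).X.hom (Spec.map φ) ≫ Spec.map φ := by
      rw [Category.assoc, hιZπ, pullback.condition]
    have h₁ := P.lift_fst _ _ w₀
    have h₂ := P.lift_snd _ _ w₀
    have hsq := IsPullback.of_right (h₁₂ := ProjBaseChangeRing.projToSpec (Fin (Nat.card ι + 1)) Ω) (v₁₃ := Spec.map φ)
      (h₂₂ := ProjBaseChangeRing.projToSpec (Fin (Nat.card ι + 1)) R)
      (by rw [h₂, hιZπ]; exact (IsPullback.of_hasPullback (A.baseChange i).X.hom (Spec.map φ)).flip) h₁ P.flip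
    haveI : IsClosedImmersion (P.lift _ _ w₀) := MorphismProperty.of_isPullback (P := @IsClosedImmersion) hsq.flip hιZ
    haveI : IsIntegral (pullback (A.baseChange i).X.hom (Spec.map φ)) :=
      GeometricallyIntegral.isIntegral_of_subsingleton (((A.baseChange i).fibre (Spec.map φ)).toAbelianVariety).X.hom
    obtain ⟨Θ, hΘ, ⟨ψ⟩⟩ := SerreTwist.exists_isAmple_nonempty_pullback_twistMod_one_iso_lineBundle_of_sq R Ω
      (pullback.fst (A.baseChange i).X.hom (Spec.map φ)) ιZ (P.lift _ _ w₀) h₁.symm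
    refine ⟨Θ, hΘ, ?_⟩
    -- `k^* c = k^* d · ((k ≫ π)^* ε^* d)⁻¹ = k^* d` (`k ≫ π` factors through `Spec Ω`) `= [k^*𝒪(1)] = [𝒪(Θ)]`
    have hk : CechPic.pullback (pullback.fst (A.baseChange i).X.hom (Spec.map φ)) (CechPic.pullback (A.baseChange i).X.hom
        (CechPic.pullback (A.baseChange i).unitSection (detClass hd))) = 1 := by
      rw [← CechPic.pullback_comp, pullback.condition, CechPic.pullback_comp, CechPic.pullback_eq_one_of_isLocalRing, map_one]
    have hψ : detClass (hd.pullback (pullback.fst (A.baseChange i).X.hom (Spec.map φ))) = Θ.cechClass := by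
      rw [detClass_eq_of_iso ψ (hd.pullback _) Θ.toUnitCocycle.isFiniteLocallyFree_lineBundle, UnitCocycle.detClass_lineBundle,
        CartierDivisor.cechClass_eq_mk]
    have h2 : CechPic.pullback (pullback.fst (A.baseChange i).X.hom (Spec.map φ))
        (detClass (HasRank.isFiniteLocallyFree' c.hasRank_lineBundle)) = Θ.cechClass := by
      rw [hcl, map_mul, map_inv, hk, inv_one, mul_one, ← detClass_pullback, hψ]
    exact h2

end Literature.AlgebraicGeometry.AbelianSchemes

end
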